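import Literature.AnabelianGeometry.EtaleTheta.Discharge.Sec3Prop34iDivPlus
import Literature.AlgebraicGeometry.Frobenioids.PiNatFixedPoints
import Literature.AlgebraicGeometry.Frobenioids.ArithmeticFrobenioidNonDilating
import HarnessLib

/-!
# [EtTh] Prop. 3.4 (i), the NON-DILATING clause, for `Div⁺(Z^log_∞)` at the typed interface `LogDivisorModel`:
# every endomorphism of `Div⁺(Z^log_∞)` induced by an automorphism of `DIV⁺(Z^log_∞)` is non-dilating

Mochizuki, *The étale theta function and its Frobenioid-theoretic manifestations*, Publ. RIMS **45** (2009), §3,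
Prop. 3.4 (i) PDF p. 74 (printed 300): "every endomorphism of `Φ₀(Y^log)` … induced by an endomorphism of `Y^log`
over `X^log` is non-dilating"; [FrdI] Def. 1.1 (i) p. 19 (non-dilating: "if `α^char(a) ≼ a` for all primary `a`,
then `α^char` is the identity") [cite: MochizukiEtTh2009, Prop 3.4 p.74].

abc-iut cell, block C / W6 cone prover abc-iut-w6-d057, W6-TRANCHE-2 row **EtTh:Prop3.4(i)**, part (C); sequel of
`Sec3Prop34iDivPlus.lean` (p433424) over `Frobenioids/PiNatFixedPoints.lean` (p433433: automorphisms of `∏_J ℤ≥0`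
permute the coordinates).  PROOF-ONLY (theorems only).  An endomorphism of `Y^log` over `X^log` lifts to an
automorphism of the universal combinatorial covering `Z^log_∞` and acts on log-divisors by pull-back, i.e. through
an automorphism of `DIV⁺(Z^log_∞)` (permuting the prime log-divisors) that preserves `Div⁺(Z^log_∞)`; at the interface
`LogDivisorModel` (no geometric endomorphisms available) we therefore prove the clause for EVERY endomorphism
`α` of `Div⁺(Z^log_∞)` INDUCED BY an automorphism `γ` of the monoid `DIV⁺(Z^log_∞)`:

* `PiNat.map_eq_self_of_forall_isPrimary_precsim` — an automorphism `γ` of `∏_J ℤ≥0` with `γ(a) ≼ a` for every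
  primary `a` is the identity (it fixes every coordinate vector `e_j`, hence every exponent); whence
  `PiNat.isNonDilating_mulAut` — **every automorphism of `∏_J ℤ≥0` is non-dilating**;
* `LogDivisorModel.mulAut_DIVplus_eq_self_of_forall_isPrimary_precsim` — the same for `DIV⁺(Z^log_∞) ≅ ∏ ℤ≥0`,
  with the hypothesis only on the primary elements of `Div⁺(Z^log_∞)` (every prime log-divisor has a Cartier
  multiple, Prop. 3.2 (i), and `≼`/primality in `Div⁺` are those of `DIV⁺` — engine p432632);
* **`LogDivisorModel.isNonDilating_Divplus_of_induced`** — every endomorphism `α : Div⁺ → Div⁺` agreeing with some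
  `γ ∈ Aut(DIV⁺)` on `Div⁺` is NON-DILATING ([FrdI] Def. 1.1 (i), the tree's `IsNonDilating`; `Div⁺` is sharp so
  `M^char = M`, abc-iut-L1's `isNonDilating_of_forall_isPrimary`).

HONEST FRAMING: statement about the typed interface `LogDivisorModel` (nothing asserts it arises from a curve; the
identification "induced endomorphisms = restrictions of automorphisms of `DIV⁺`" is the reading stated above, not a
typed theorem about curves); the divisorial-monoid-on-`D₀` clause (c) of Prop. 3.4 (i) and `Φ₀` itself (abstract data
in `DivisorMonoids`, F-2490 schema) are not treated; no side is taken on [IUTchIII] Cor. 3.12; typed ≠ proved for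
anything else.
-/

noncomputable section

namespace Literature.AlgebraicGeometry.Frobenioids

namespace PiNat

open Function

universe u

variable {J : Type u}

/-- **Rigidity of `∏_J ℤ≥0`**: an automorphism `γ` with `γ(a) ≼ a` for every primary `a` is the identity — `γ`
carries `e_j` to some `e_{j'}` (`exists_map_single_one`) with `e_{j'} ≼ e_j`, so `j' = j`, and then every exponent is
fixed (`coeff_map_of_map_single`). [cite: MochizukiFrdI2008, Def. 1.1(i) p.19] -/
theorem map_eq_self_of_forall_isPrimary_precsim (γ : MulAut (Multiplicative (J → ℕ)))
    (h : ∀ a : Multiplicative (J → ℕ), IsPrimary a → Precsim (γ a) a) (f : Multiplicative (J → ℕ)) : γ f = f := by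
  classical
  have hfix : ∀ j : J, γ (single j 1) = single j 1 := by
    intro j
    obtain ⟨j', hj'⟩ := exists_map_single_one γ j
    have hprec : Precsim (single j' 1) (single j 1) := by rw [← hj']; exact h _ (isPrimary_single j one_ne_zero)
    obtain ⟨n, -, hn⟩ := hprec
    rw [single_pow, single_dvd_iff] at hn
    by_cases hjj : j' = j
    · rw [hj', hjj]
    · rw [coeff_single_of_ne hjj] at hn
      exact absurd hn (Nat.not_succ_le_zero 0)
  exact ext fun j => coeff_map_of_map_single γ (hfix j) f

/-- **Every automorphism of `∏_J ℤ≥0` is non-dilating** ([FrdI] Def. 1.1 (i); `∏_J ℤ≥0` is sharp, so `M^char = M`).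
[cite: MochizukiFrdI2008, Def. 1.1(i) p.19] -/
theorem isNonDilating_mulAut (γ : MulAut (Multiplicative (J → ℕ))) :
    IsNonDilating (γ : Multiplicative (J → ℕ) →* Multiplicative (J → ℕ)) :=
  isNonDilating_of_forall_isPrimary isSharp _ fun h =>
    MonoidHom.ext fun f => map_eq_self_of_forall_isPrimary_precsim γ h f

end PiNat

end Literature.AlgebraicGeometry.Frobenioids

namespace Literature.AnabelianGeometry.EtaleTheta

open Literature.AlgebraicGeometry.Frobenioids Function

universe u

namespace LogDivisorModel

variable (Z : LogDivisorModel.{u})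

/-- **Rigidity of `DIV⁺(Z^log_∞)` tested on Cartier divisors**: an automorphism `γ` of `DIV⁺(Z^log_∞)` such that
`γ(a) ≼ a` for every effective Cartier log-divisor `a` that is PRIMARY IN `Div⁺(Z^log_∞)` is the identity.  (Every
primary element `c` of `DIV⁺ ≅ ∏ ℤ≥0` has a Cartier power `c^n ∈ Div⁺`, Prop. 3.2 (i), primary in `Div⁺` by the
engine's `isPrimary_coe_iff`; `γ(c^n) ≼ c^n` gives `γ(c) ≼ c`; then `PiNat` rigidity.) [cite: MochizukiEtTh2009, Prop 3.4 p.74] -/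
theorem mulAut_DIVplus_eq_self_of_forall_isPrimary_precsim (γ : MulAut ↥Z.DIVplus)
    (h : ∀ a : ↥Z.Divplus, IsPrimary a →
      Precsim (γ ⟨(a : Z.DIV), Z.Divplus_le_DIVplus a.2⟩) ⟨(a : Z.DIV), Z.Divplus_le_DIVplus a.2⟩)
    (x : ↥Z.DIVplus) : γ x = x := by
  obtain ⟨e⟩ := Z.nonempty_piNatEquivDIVplus
  have hsharp : IsSharp ↥Z.DIVplus := Z.isPerfFactorialWeak_DIVplus.isDivisorial.isSharp
  have hsat := Z.isGroupSaturated_Divplus_comap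
  have hdense := Z.mem_perfSaturation_Divplus_comap
  -- the (definitional) identification `Div⁺ ∩ DIV⁺ ≅ Div⁺`
  let ec : ↥(Z.Divplus.comap Z.DIVplus.subtype) ≃* ↥Z.Divplus :=
    { toFun := fun y => ⟨(y.1 : Z.DIV), y.2⟩
      invFun := fun y => ⟨⟨y.1, Z.Divplus_le_DIVplus y.2⟩, y.2⟩
      left_inv := fun _ => rfl
      right_inv := fun _ => rfl
      map_mul' := fun _ _ => rfl }
  -- `γ(c) ≼ c` for every primary `c` of `DIV⁺`
  have hP : ∀ c : ↥Z.DIVplus, IsPrimary c → Precsim (γ c) c := by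
    intro c hc
    obtain ⟨n, hn⟩ := (mem_perfSaturation_iff _ _).mp (hdense c)
    let cM : ↥(Z.Divplus.comap Z.DIVplus.subtype) := ⟨c ^ (n : ℕ), hn⟩
    have hcM : IsPrimary cM :=
      (GroupSaturatedSubmonoid.isPrimary_coe_iff hsharp hsat hdense).mp (hc.pow hsharp n.pos)
    have hcD : IsPrimary (ec cM) := hcM.map_mulEquiv ec
    have h1 : Precsim (γ (c ^ (n : ℕ))) (c ^ (n : ℕ)) := h (ec cM) hcD
    exact ((precsim_pow_self (γ c) n.pos).trans (by rw [← map_pow]; exact h1)).trans (pow_precsim_self c n.pos)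
  -- transport to `∏ ℤ≥0` and apply rigidity there
  let γ' : MulAut (Multiplicative (Z.Cusp ⊕ Z.Comp → ℕ)) := e.trans ((γ : ↥Z.DIVplus ≃* ↥Z.DIVplus).trans e.symm)
  have hγ' : ∀ a, IsPrimary a → Precsim (γ' a) a := by
    intro a ha
    have h2 : Precsim (e.symm (γ (e a))) (e.symm (e a)) :=
      (precsim_map_iff e.symm).mpr (hP (e a) (ha.map_mulEquiv e))
    simpa [γ'] using h2
  have h3 := PiNat.map_eq_self_of_forall_isPrimary_precsim γ' hγ' (e.symm x)
  have h4 : γ' (e.symm x) = e.symm (γ x) := by simp [γ']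
  rw [h4] at h3
  simpa using congrArg e h3

/-- **[EtTh] Prop. 3.4 (i), non-dilating clause, for `Div⁺(Z^log_∞)`**: every endomorphism `α` of `Div⁺(Z^log_∞)`
INDUCED BY an automorphism `γ` of `DIV⁺(Z^log_∞)` (i.e. `α(x) = γ(x)` in `DIV⁺` for `x ∈ Div⁺`) is non-dilating
([FrdI] Def. 1.1 (i)).  In print the endomorphisms in question are those "induced by an endomorphism of `Y^log`
over `X^log`", which act on log-divisors through automorphisms of `Z^log_∞`, hence of `DIV⁺(Z^log_∞)`.
[cite: MochizukiEtTh2009, Prop 3.4 p.74] -/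
theorem isNonDilating_Divplus_of_induced (γ : MulAut ↥Z.DIVplus) (α : ↥Z.Divplus →* ↥Z.Divplus)
    (hα : ∀ x : ↥Z.Divplus,
      ((α x : ↥Z.Divplus) : Z.DIV) = ((γ ⟨(x : Z.DIV), Z.Divplus_le_DIVplus x.2⟩ : ↥Z.DIVplus) : Z.DIV)) :
    IsNonDilating α := by
  refine isNonDilating_of_forall_isPrimary Z.isPerfFactorialWeak_Divplus.isDivisorial.isSharp α fun H => ?_
  -- Def. 1.1 (i)'s hypothesis for `α` says `γ(a) ≼ a` on the primary Cartier `a`; hence `γ = id`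
  have hγ : ∀ x : ↥Z.DIVplus, γ x = x := by
    refine Z.mulAut_DIVplus_eq_self_of_forall_isPrimary_precsim γ fun a hprim => ?_
    obtain ⟨n, hn, c, hc⟩ := H a hprim
    refine ⟨n, hn, ⟨(c : Z.DIV), Z.Divplus_le_DIVplus c.2⟩, Subtype.ext ?_⟩
    have := congrArg (fun y : ↥Z.Divplus => (y : Z.DIV)) hc
    simp only [SubmonoidClass.coe_pow, Submonoid.coe_mul, hα] at this
    simpa [SubmonoidClass.coe_pow, Submonoid.coe_mul] using this
  refine MonoidHom.ext fun x => Subtype.ext ?_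
  rw [hα x, hγ]
  rfl

end LogDivisorModel

end Literature.AnabelianGeometry.EtaleTheta

end
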